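import Summits.AtomisticToContinuum.BoseEinsteinCondensation.Theorems.BECSwapNoCatastropheTorusHalfSwapOverlapCruxOfChord
import HarnessLib

/-!
# Crux `TorusHalfSwapOverlap` (stmt-AtomisticToContinuum-14393), line `birth`: the singular chord reduces to the
# HARD-CORE chord (profiles unbounded on `[0, ∞)`) given rank 3

Route `BECSwapNoCatastrophe` (sub-problem `BoseEinsteinCondensation`), lead c3 (2026-08-17). The line's open stub
`stub_singularChord` asks the midpoint-chord overlap claim for every repulsive finite-range `v` that is NOT bounded on all
of `ℝ` — a class that, by a quantifier artefact (`v` is only ever evaluated at norms `≥ 0`), also contains profiles that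
are bounded on `[0, ∞)` and unbounded only on the never-used negative half-line. This file proves the registered glue
stub `stub_singularOfHardCore`: given rank 3 `TorusSwapPathRigidity` (stmt-AtomisticToContinuum-14394, hypothesis by
name), the singular chord follows from the HARD-CORE chord `stub_hardCoreChord` — the same claim for profiles unbounded
ON `[0, ∞)` (hard cores `⊤ · 1_{[0,a]}` being the case of interest). Mechanism: replacing `v` by `v · 1_{[0,∞)}` does not
change the periodised potential (`periodizedPotential_indicator_Ici`), hence none of the two-copy forms, and the modified
profile is bounded and admissible, so the landed glue `stub_chordOfPath` (rank 3 ⇒ bounded chord) covers the artefact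
class. Consequence: `torusHalfSwapOverlap_of_pathRigidity_of_hardCoreChord : TorusSwapPathRigidity → (hard-core chord) →
TorusHalfSwapOverlap`, the crux BY NAME from rank 3 and the hard-core chord. [folklore bookkeeping]
-/

noncomputable section

open MeasureTheory Filter
open scoped ENNReal NNReal BigOperators ComplexConjugate

namespace Summit.AtomisticToContinuum.BoseEinsteinCondensation.Cruxes.TorusHalfSwapOverlap.Birth

open Literature.MathematicalPhysics.QuantumManyBody.BoseGas
open Summit.AtomisticToContinuum.BoseEinsteinCondensation.Theses.BECSwapNoCatastrophe
  (TorusHalfSwapOverlap TorusSwapPathRigidity)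

namespace HardCoreReduction

/-- Truncating a profile to `[0, ∞)` does not change its periodisation: `v` is only evaluated at norms. [folklore] -/
theorem periodizedPotential_indicator_Ici (v : ℝ → ℝ≥0∞) (L : ℝ) :
    periodizedPotential (Set.indicator (Set.Ici 0) v) L = periodizedPotential v L := by
  funext x
  unfold periodizedPotential
  exact tsum_congr fun n => Set.indicator_of_mem (Set.mem_Ici.mpr (norm_nonneg _)) v

/-- Hence the periodic pair interaction is unchanged too. [folklore] -/
theorem periodicInteraction_indicator_Ici {N : ℕ} (v : ℝ → ℝ≥0∞) (L : ℝ) :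
    (periodicInteraction (Set.indicator (Set.Ici 0) v) L : Config N → ℝ≥0∞) = periodicInteraction v L := by
  funext X
  unfold periodicInteraction
  rw [periodizedPotential_indicator_Ici]

/-- The truncated profile of an admissible profile is admissible. [folklore] -/
theorem isRepulsiveFiniteRange_indicator_Ici {v : ℝ → ℝ≥0∞} (hv : IsRepulsiveFiniteRange v) :
    IsRepulsiveFiniteRange (Set.indicator (Set.Ici 0) v) := by
  refine ⟨hv.1.indicator measurableSet_Ici, ?_⟩
  obtain ⟨R₀, hR₀⟩ := hv.2
  refine ⟨R₀, fun r hr => ?_⟩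
  by_cases h : r ∈ Set.Ici (0 : ℝ)
  · rw [Set.indicator_of_mem h, hR₀ r hr]
  · rw [Set.indicator_of_notMem h]

/-- A profile bounded on `[0, ∞)` has an everywhere-bounded truncation. [folklore] -/
theorem bounded_indicator_Ici {v : ℝ → ℝ≥0∞} (hb : ∃ M : NNReal, ∀ r, 0 ≤ r → v r ≤ M) :
    ∃ M : NNReal, ∀ r, Set.indicator (Set.Ici 0) v r ≤ M := by
  obtain ⟨M, hM⟩ := hb
  refine ⟨M, fun r => ?_⟩
  by_cases h : r ∈ Set.Ici (0 : ℝ)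
  · rw [Set.indicator_of_mem h]; exact hM r (Set.mem_Ici.mp h)
  · rw [Set.indicator_of_notMem h]; exact zero_le

end HardCoreReduction

open HardCoreReduction

/-- **Registered glue stub `stub_singularOfHardCore`: rank 3 and the hard-core chord give the singular chord.** Case split
on boundedness ON `[0, ∞)`: if `v` is bounded there, its truncation `v · 1_{[0,∞)}` is bounded, admissible and has the
same periodisation, so `stub_chordOfPath` (rank 3 ⇒ bounded chord) applies to it and its conclusion is literally the one
for `v`; otherwise the hard-core chord hypothesis fires. [folklore] -/
theorem stub_singularOfHardCore :
    TorusSwapPathRigidity →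
    (∀ v : ℝ → ℝ≥0∞, IsRepulsiveFiniteRange v → (¬ ∃ M : NNReal, ∀ r, 0 ≤ r → v r ≤ M) →
      ∃ ρ₀ : ℝ, 0 < ρ₀ ∧ ∀ ρ : ℝ, 0 < ρ → ρ < ρ₀ → ∃ η : ℝ, 0 < η ∧ ∀ᶠ n : ℕ in atTop,
        let L : ℝ := sideLength ρ (n + 1)
        let C2 : Set (Config (n + 1) × Config (n + 1)) := (cellN (n + 1) L) ×ˢ (cellN (n + 1) L)
        let E2z : (Config (n + 1) × Config (n + 1) → ℂ) → ℝ≥0∞ := fun Θ => ∫⁻ Z in C2,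
          kineticDensity (fun X => Θ (X, Z.2)) Z.1 + kineticDensity (fun Y => Θ (Z.1, Y)) Z.2 +
            (periodicInteraction v L Z.1 + periodicInteraction v L Z.2) * (‖Θ Z‖₊ : ENNReal) ^ 2
        let E2h : (Config (n + 1) × Config (n + 1) → ℂ) → ℝ≥0∞ := fun Θ => ∫⁻ Z in C2,
          (kineticDensity (fun X => Θ (X, Z.2)) Z.1 + kineticDensity (fun Y => Θ (Z.1, Y)) Z.2 +
            (periodicInteraction v L (Fin.tail Z.1) + periodicInteraction v L (Fin.tail Z.2) +
              ∑ j : Fin n, (2 : ENNReal)⁻¹ * (periodizedPotential v L (Z.1 0 - Z.1 j.succ) +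
                periodizedPotential v L (Z.2 0 - Z.2 j.succ) + periodizedPotential v L (Z.2 0 - Z.1 j.succ) +
                periodizedPotential v L (Z.1 0 - Z.2 j.succ))) * (‖Θ Z‖₊ : ENNReal) ^ 2)
        let Adm : (Config (n + 1) × Config (n + 1) → ℂ) → Prop := fun Θ => ContDiff ℝ 1 Θ ∧
          (∀ (Z : Config (n + 1) × Config (n + 1)) (i : Fin (n + 1)) (k : Fin 3),
            Θ (Z.1 + Pi.single i (EuclideanSpace.single k L), Z.2) = Θ Z ∧
              Θ (Z.1, Z.2 + Pi.single i (EuclideanSpace.single k L)) = Θ Z) ∧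
          ∫⁻ Z in C2, (‖Θ Z‖₊ : ENNReal) ^ 2 = 1
        ∃ δ : ℝ≥0∞, 0 < δ ∧ ∀ Φ Θ : Config (n + 1) × Config (n + 1) → ℂ,
          Adm Φ → E2z Φ ≤ (⨅ (Θ' : Config (n + 1) × Config (n + 1) → ℂ) (_ : Adm Θ'), E2z Θ') + δ →
          Adm Θ → E2h Θ ≤ (⨅ (Θ' : Config (n + 1) × Config (n + 1) → ℂ) (_ : Adm Θ'), E2h Θ') + δ →
          ENNReal.ofReal (1 / 2 + η) ≤ (‖∫ Z in C2, (starRingEnd ℂ) (Θ Z) * Φ Z‖₊ : ENNReal) ^ 2) →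
    ∀ v : ℝ → ℝ≥0∞, IsRepulsiveFiniteRange v → (¬ ∃ M : NNReal, ∀ r, v r ≤ M) →
      ∃ ρ₀ : ℝ, 0 < ρ₀ ∧ ∀ ρ : ℝ, 0 < ρ → ρ < ρ₀ → ∃ η : ℝ, 0 < η ∧ ∀ᶠ n : ℕ in atTop,
        let L : ℝ := sideLength ρ (n + 1)
        let C2 : Set (Config (n + 1) × Config (n + 1)) := (cellN (n + 1) L) ×ˢ (cellN (n + 1) L)
        let E2z : (Config (n + 1) × Config (n + 1) → ℂ) → ℝ≥0∞ := fun Θ => ∫⁻ Z in C2,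
          kineticDensity (fun X => Θ (X, Z.2)) Z.1 + kineticDensity (fun Y => Θ (Z.1, Y)) Z.2 +
            (periodicInteraction v L Z.1 + periodicInteraction v L Z.2) * (‖Θ Z‖₊ : ENNReal) ^ 2
        let E2h : (Config (n + 1) × Config (n + 1) → ℂ) → ℝ≥0∞ := fun Θ => ∫⁻ Z in C2,
          (kineticDensity (fun X => Θ (X, Z.2)) Z.1 + kineticDensity (fun Y => Θ (Z.1, Y)) Z.2 +
            (periodicInteraction v L (Fin.tail Z.1) + periodicInteraction v L (Fin.tail Z.2) +
              ∑ j : Fin n, (2 : ENNReal)⁻¹ * (periodizedPotential v L (Z.1 0 - Z.1 j.succ) +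
                periodizedPotential v L (Z.2 0 - Z.2 j.succ) + periodizedPotential v L (Z.2 0 - Z.1 j.succ) +
                periodizedPotential v L (Z.1 0 - Z.2 j.succ))) * (‖Θ Z‖₊ : ENNReal) ^ 2)
        let Adm : (Config (n + 1) × Config (n + 1) → ℂ) → Prop := fun Θ => ContDiff ℝ 1 Θ ∧
          (∀ (Z : Config (n + 1) × Config (n + 1)) (i : Fin (n + 1)) (k : Fin 3),
            Θ (Z.1 + Pi.single i (EuclideanSpace.single k L), Z.2) = Θ Z ∧
              Θ (Z.1, Z.2 + Pi.single i (EuclideanSpace.single k L)) = Θ Z) ∧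
          ∫⁻ Z in C2, (‖Θ Z‖₊ : ENNReal) ^ 2 = 1
        ∃ δ : ℝ≥0∞, 0 < δ ∧ ∀ Φ Θ : Config (n + 1) × Config (n + 1) → ℂ,
          Adm Φ → E2z Φ ≤ (⨅ (Θ' : Config (n + 1) × Config (n + 1) → ℂ) (_ : Adm Θ'), E2z Θ') + δ →
          Adm Θ → E2h Θ ≤ (⨅ (Θ' : Config (n + 1) × Config (n + 1) → ℂ) (_ : Adm Θ'), E2h Θ') + δ →
          ENNReal.ofReal (1 / 2 + η) ≤ (‖∫ Z in C2, (starRingEnd ℂ) (Θ Z) * Φ Z‖₊ : ENNReal) ^ 2 := by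
  intro hPR hHC v hv hb
  by_cases hb' : ∃ M : NNReal, ∀ r, 0 ≤ r → v r ≤ M
  · have key := stub_chordOfPath hPR (Set.indicator (Set.Ici 0) v) (isRepulsiveFiniteRange_indicator_Ici hv)
      (bounded_indicator_Ici hb')
    simp only [periodizedPotential_indicator_Ici, periodicInteraction_indicator_Ici] at key
    exact key
  · exact hHC v hv hb'

/-- **The crux BY NAME from rank 3 and the hard-core chord**: `TorusSwapPathRigidity` (stmt-AtomisticToContinuum-14394) and
the hard-core midpoint-chord claim (profiles unbounded on `[0, ∞)`) imply `TorusHalfSwapOverlap`, through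
`stub_singularOfHardCore` and the landed composition `torusHalfSwapOverlap_of_pathRigidity_of_singularChord`. [folklore] -/
theorem torusHalfSwapOverlap_of_pathRigidity_of_hardCoreChord (h0 : TorusSwapPathRigidity)
    (hHC :
      ∀ v : ℝ → ℝ≥0∞, IsRepulsiveFiniteRange v → (¬ ∃ M : NNReal, ∀ r, 0 ≤ r → v r ≤ M) →
        ∃ ρ₀ : ℝ, 0 < ρ₀ ∧ ∀ ρ : ℝ, 0 < ρ → ρ < ρ₀ → ∃ η : ℝ, 0 < η ∧ ∀ᶠ n : ℕ in atTop,
          let L : ℝ := sideLength ρ (n + 1)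
          let C2 : Set (Config (n + 1) × Config (n + 1)) := (cellN (n + 1) L) ×ˢ (cellN (n + 1) L)
          let E2z : (Config (n + 1) × Config (n + 1) → ℂ) → ℝ≥0∞ := fun Θ => ∫⁻ Z in C2,
            kineticDensity (fun X => Θ (X, Z.2)) Z.1 + kineticDensity (fun Y => Θ (Z.1, Y)) Z.2 +
              (periodicInteraction v L Z.1 + periodicInteraction v L Z.2) * (‖Θ Z‖₊ : ENNReal) ^ 2
          let E2h : (Config (n + 1) × Config (n + 1) → ℂ) → ℝ≥0∞ := fun Θ => ∫⁻ Z in C2,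
            (kineticDensity (fun X => Θ (X, Z.2)) Z.1 + kineticDensity (fun Y => Θ (Z.1, Y)) Z.2 +
              (periodicInteraction v L (Fin.tail Z.1) + periodicInteraction v L (Fin.tail Z.2) +
                ∑ j : Fin n, (2 : ENNReal)⁻¹ * (periodizedPotential v L (Z.1 0 - Z.1 j.succ) +
                  periodizedPotential v L (Z.2 0 - Z.2 j.succ) + periodizedPotential v L (Z.2 0 - Z.1 j.succ) +
                  periodizedPotential v L (Z.1 0 - Z.2 j.succ))) * (‖Θ Z‖₊ : ENNReal) ^ 2)
          let Adm : (Config (n + 1) × Config (n + 1) → ℂ) → Prop := fun Θ => ContDiff ℝ 1 Θ ∧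
            (∀ (Z : Config (n + 1) × Config (n + 1)) (i : Fin (n + 1)) (k : Fin 3),
              Θ (Z.1 + Pi.single i (EuclideanSpace.single k L), Z.2) = Θ Z ∧
                Θ (Z.1, Z.2 + Pi.single i (EuclideanSpace.single k L)) = Θ Z) ∧
            ∫⁻ Z in C2, (‖Θ Z‖₊ : ENNReal) ^ 2 = 1
          ∃ δ : ℝ≥0∞, 0 < δ ∧ ∀ Φ Θ : Config (n + 1) × Config (n + 1) → ℂ,
            Adm Φ → E2z Φ ≤ (⨅ (Θ' : Config (n + 1) × Config (n + 1) → ℂ) (_ : Adm Θ'), E2z Θ') + δ →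
            Adm Θ → E2h Θ ≤ (⨅ (Θ' : Config (n + 1) × Config (n + 1) → ℂ) (_ : Adm Θ'), E2h Θ') + δ →
            ENNReal.ofReal (1 / 2 + η) ≤ (‖∫ Z in C2, (starRingEnd ℂ) (Θ Z) * Φ Z‖₊ : ENNReal) ^ 2) :
    TorusHalfSwapOverlap :=
  torusHalfSwapOverlap_of_pathRigidity_of_singularChord h0 (stub_singularOfHardCore h0 hHC)

end Summit.AtomisticToContinuum.BoseEinsteinCondensation.Cruxes.TorusHalfSwapOverlap.Birth

end
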